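import Mathlib
import HarnessLib

/-!
# LINE g7-δ «member selection», T1 tool: CHEAP COLLARS BY A DISCRETE CHOICE OF THE GRID OFFSET

Crux `NearExtremalTransiencePerFlow` (stmt-NavierStokesRegularity-26567), line δ `member_selection`
(`Cruxes/NearExtremalTransiencePerFlow/Lines/member_selection.lean|.md`): the selection step of T1
`stub_coherentSelection` cuts the stretching integral over the CORES of a cubic partition of side `h`, the cores
being the cells minus COLLARS, and needs the collars to be cheap in the three densities `|j|`, `|ω|²`, `|∇ω|²`
simultaneously («collars of width ρ made cheap … by averaging over grid offsets», card §Idea; critic N1: `s_col`).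
This file proves the averaging step in a DISCRETE, Fubini-free form: among the `N` diagonal offsets `(j/N)·h`,
`j < N`, of the grid, the coordinate slabs of half-width `h/(2N)` around the faces are pairwise DISJOINT in `j`
(integer arithmetic), so for any finite family of non-negative densities some single offset `j` makes every density's
collar mass at most `(#coordinates · #densities / N)` of its total mass.

* `abs_sub_div_add_int_ge` — the arithmetic core: `1/N ≤ |(j' − j)/N + m|` for `j ≠ j' < N`, `m ∈ ℤ`;
* `disjoint_gridSlab` — the slabs `{x | ∃ k : ℤ, |x i / h − j/N − k| < 1/(2N)}` are pairwise disjoint in `j < N`;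
* `sum_lintegral_gridSlab_le` — `Σ_{j<N} ∫_{slab i j} f ≤ ∫ f`;
* `sum_lintegral_gridCollar_le` — `Σ_{j<N} ∫_{collar j} f ≤ #ι · ∫ f` (collar = union of the slabs over the coordinates);
* `exists_gridCollar_lintegral_le` — **pigeonhole** (`ℝ≥0∞` form): for `f₁,…,f_m : E → ℝ≥0∞` of finite mass there is
  `j < N` with `∫_{collar j} f_l ≤ (#ι · m / N) ∫ f_l` for every `l`;
* `exists_gridCollar_integral_le` — the same for non-negative integrable real densities (Bochner integrals).

Pure measure theory on `EuclideanSpace ℝ ι`; nothing here is a statement about Navier–Stokes. The crux 26567, T1, T3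
and NS regularity remain OPEN. No summit is proved by a line.
-/

noncomputable section

open MeasureTheory Set Filter Topology
open scoped ENNReal NNReal

namespace Summit.NavierStokesRegularity.NavierStokesRegularity.Theorems.NearExtremalTransiencePerFlow.MemberSelection

set_option linter.dupNamespace false

/-! ### Arithmetic: distinct offsets `j/N` stay `1/N` apart modulo `ℤ` -/

/-- For integers `d, m, N` with `0 < |d| < N`: `d + m N ≠ 0`. [folklore] -/
theorem int_add_mul_ne_zero {d m : ℤ} {N : ℕ} (hd0 : d ≠ 0) (hdN : d.natAbs < N) : d + m * N ≠ 0 := by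
  intro h
  have hdvd : (N : ℤ) ∣ d := ⟨-m, by linarith⟩
  have := Int.eq_zero_of_dvd_of_natAbs_lt_natAbs hdvd (by simpa using hdN)
  exact hd0 this

/-- The arithmetic core: for `j ≠ j'` below `N` and any integer `m`, `1/N ≤ |(j' − j)/N + m|`. [folklore] -/
theorem abs_sub_div_add_int_ge {N j j' : ℕ} (hN : 0 < N) (hj : j < N) (hj' : j' < N) (hne : j ≠ j') (m : ℤ) :
    (1 : ℝ) / N ≤ |((j' : ℝ) - j) / N + m| := by
  have hNr : (0 : ℝ) < N := by exact_mod_cast hN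
  set d : ℤ := (j' : ℤ) - j with hd
  have hd0 : d ≠ 0 := by
    rw [hd]; omega
  have hdN : d.natAbs < N := by
    rw [hd]; omega
  have hne0 : d + m * N ≠ 0 := int_add_mul_ne_zero hd0 hdN
  have h1 : (1 : ℤ) ≤ |d + m * N| := Int.one_le_abs hne0
  have h1r : (1 : ℝ) ≤ |(d : ℝ) + m * N| := by exact_mod_cast h1
  have hdr : (d : ℝ) = (j' : ℝ) - j := by rw [hd]; push_cast; ring
  have heq : ((j' : ℝ) - j) / N + m = ((d : ℝ) + m * N) / N := by
    rw [hdr]; field_simp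
  rw [heq, abs_div, abs_of_pos hNr]
  exact div_le_div_of_nonneg_right h1r hNr.le

/-! ### The slabs and collars of the shifted grids -/

section Grid

variable {ι : Type*} [Fintype ι]

/-- The coordinate slabs of offset `j` are measurable. [folklore] -/
theorem measurableSet_gridSlab (h : ℝ) (N : ℕ) (i : ι) (j : ℕ) :
    MeasurableSet {x : EuclideanSpace ℝ ι | ∃ k : ℤ, |x i / h - j / N - k| < 1 / (2 * N)} := by
  have hset : {x : EuclideanSpace ℝ ι | ∃ k : ℤ, |x i / h - j / N - k| < 1 / (2 * N)} =
      ⋃ k : ℤ, {x : EuclideanSpace ℝ ι | |x i / h - j / N - k| < 1 / (2 * N)} := by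
    ext x; simp
  rw [hset]
  refine MeasurableSet.iUnion fun k => ?_
  have hcont : Continuous fun x : EuclideanSpace ℝ ι => |x i / h - j / N - k| :=
    ((((EuclideanSpace.proj i : EuclideanSpace ℝ ι →L[ℝ] ℝ).continuous.div_const h).sub
      continuous_const).sub continuous_const).abs
  exact (isOpen_lt hcont continuous_const).measurableSet

/-- The collar of offset `j` (union of the slabs over the coordinates) is measurable. [folklore] -/
theorem measurableSet_gridCollar (h : ℝ) (N : ℕ) (j : ℕ) :
    MeasurableSet {x : EuclideanSpace ℝ ι | ∃ i, ∃ k : ℤ, |x i / h - j / N - k| < 1 / (2 * N)} := by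
  have hset : {x : EuclideanSpace ℝ ι | ∃ i, ∃ k : ℤ, |x i / h - j / N - k| < 1 / (2 * N)} =
      ⋃ i : ι, {x : EuclideanSpace ℝ ι | ∃ k : ℤ, |x i / h - j / N - k| < 1 / (2 * N)} := by
    ext x; simp
  rw [hset]
  exact MeasurableSet.iUnion fun i => measurableSet_gridSlab h N i j

omit [Fintype ι] in
/-- **Disjointness**: for `j ≠ j'` below `N`, the `i`-slabs of offsets `j` and `j'` are disjoint. [folklore] -/
theorem disjoint_gridSlab (h : ℝ) {N : ℕ} (hN : 0 < N) (i : ι) {j j' : ℕ} (hj : j < N) (hj' : j' < N)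
    (hne : j ≠ j') :
    Disjoint {x : EuclideanSpace ℝ ι | ∃ k : ℤ, |x i / h - j / N - k| < 1 / (2 * N)}
      {x : EuclideanSpace ℝ ι | ∃ k : ℤ, |x i / h - j' / N - k| < 1 / (2 * N)} := by
  rw [Set.disjoint_left]
  rintro x ⟨k, hk⟩ ⟨k', hk'⟩
  have hNr : (0 : ℝ) < N := by exact_mod_cast hN
  have hcore := abs_sub_div_add_int_ge hN hj hj' hne (k' - k)
  -- `(j' - j)/N + (k' - k) = (x i/h - j/N - k) - (x i/h - j'/N - k')`
  have heq : ((j' : ℝ) - j) / N + ((k' - k : ℤ) : ℝ) =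
      (x i / h - j / N - k) - (x i / h - j' / N - k') := by
    push_cast; ring
  rw [heq] at hcore
  have htri : |(x i / h - j / N - k) - (x i / h - j' / N - k')| < 1 / (2 * N) + 1 / (2 * N) :=
    (abs_sub _ _).trans_lt (add_lt_add hk hk')
  have hsum : (1 : ℝ) / (2 * N) + 1 / (2 * N) = 1 / N := by field_simp; ring
  linarith

/-- `Σ_{j<N} ∫_{slab i j} f ≤ ∫ f` (the slabs are disjoint). [folklore] -/
theorem sum_lintegral_gridSlab_le (h : ℝ) {N : ℕ} (hN : 0 < N) (i : ι) (f : EuclideanSpace ℝ ι → ℝ≥0∞) :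
    ∑ j ∈ Finset.range N, ∫⁻ x in {x : EuclideanSpace ℝ ι | ∃ k : ℤ, |x i / h - j / N - k| < 1 / (2 * N)}, f x ≤
      ∫⁻ x, f x := by
  rw [← lintegral_biUnion_finset]
  · exact setLIntegral_le_lintegral _ _
  · intro j hj j' hj' hne
    exact disjoint_gridSlab h hN i (Finset.mem_range.1 hj) (Finset.mem_range.1 hj') hne
  · intro j _
    exact measurableSet_gridSlab h N i j

/-- `∫_{collar j} f ≤ Σ_i ∫_{slab i j} f`. [folklore] -/
theorem lintegral_gridCollar_le_sum (h : ℝ) (N : ℕ) (j : ℕ) (f : EuclideanSpace ℝ ι → ℝ≥0∞) :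
    ∫⁻ x in {x : EuclideanSpace ℝ ι | ∃ i, ∃ k : ℤ, |x i / h - j / N - k| < 1 / (2 * N)}, f x ≤
      ∑ i : ι, ∫⁻ x in {x : EuclideanSpace ℝ ι | ∃ k : ℤ, |x i / h - j / N - k| < 1 / (2 * N)}, f x := by
  have hset : {x : EuclideanSpace ℝ ι | ∃ i, ∃ k : ℤ, |x i / h - j / N - k| < 1 / (2 * N)} =
      ⋃ i : ι, {x : EuclideanSpace ℝ ι | ∃ k : ℤ, |x i / h - j / N - k| < 1 / (2 * N)} := by
    ext x; simp
  rw [hset]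
  calc ∫⁻ x in ⋃ i : ι, {x : EuclideanSpace ℝ ι | ∃ k : ℤ, |x i / h - j / N - k| < 1 / (2 * N)}, f x
      ≤ ∑' i : ι, ∫⁻ x in {x : EuclideanSpace ℝ ι | ∃ k : ℤ, |x i / h - j / N - k| < 1 / (2 * N)}, f x :=
        lintegral_iUnion_le _ _
    _ = ∑ i : ι, ∫⁻ x in {x : EuclideanSpace ℝ ι | ∃ k : ℤ, |x i / h - j / N - k| < 1 / (2 * N)}, f x :=
        tsum_fintype _

/-- **`Σ_{j<N} ∫_{collar j} f ≤ #ι · ∫ f`**. [folklore] -/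
theorem sum_lintegral_gridCollar_le (h : ℝ) {N : ℕ} (hN : 0 < N) (f : EuclideanSpace ℝ ι → ℝ≥0∞) :
    ∑ j ∈ Finset.range N, ∫⁻ x in {x : EuclideanSpace ℝ ι | ∃ i, ∃ k : ℤ, |x i / h - j / N - k| < 1 / (2 * N)}, f x ≤
      (Fintype.card ι : ℝ≥0∞) * ∫⁻ x, f x := by
  calc ∑ j ∈ Finset.range N, ∫⁻ x in {x : EuclideanSpace ℝ ι | ∃ i, ∃ k : ℤ, |x i / h - j / N - k| < 1 / (2 * N)}, f x
      ≤ ∑ j ∈ Finset.range N, ∑ i : ι,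
          ∫⁻ x in {x : EuclideanSpace ℝ ι | ∃ k : ℤ, |x i / h - j / N - k| < 1 / (2 * N)}, f x :=
        Finset.sum_le_sum fun j _ => lintegral_gridCollar_le_sum h N j f
    _ = ∑ i : ι, ∑ j ∈ Finset.range N,
          ∫⁻ x in {x : EuclideanSpace ℝ ι | ∃ k : ℤ, |x i / h - j / N - k| < 1 / (2 * N)}, f x :=
        Finset.sum_comm
    _ ≤ ∑ _i : ι, ∫⁻ x, f x := Finset.sum_le_sum fun i _ => sum_lintegral_gridSlab_le h hN i f
    _ = (Fintype.card ι : ℝ≥0∞) * ∫⁻ x, f x := by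
        rw [Finset.sum_const, Finset.card_univ, nsmul_eq_mul]

/-! ### Pigeonhole over the offsets -/

/-- **Cheap collars, `ℝ≥0∞` form.** For `N ≥ 1` offsets (any side `h`) and densities
`f₀, …, f_{m-1} : ℝ^ι → ℝ≥0∞` of finite mass (no measurability needed), some offset `j < N` makes EVERY collar cheap:
`∫_{collar j} f_l ≤ (#ι · m / N) · ∫ f_l`. [folklore] -/
theorem exists_gridCollar_lintegral_le (h : ℝ) {N : ℕ} (hN : 0 < N) {m : ℕ} (f : Fin m → EuclideanSpace ℝ ι → ℝ≥0∞)
    (hfin : ∀ l, ∫⁻ x, f l x ≠ ⊤) :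
    ∃ j < N, ∀ l, ∫⁻ x in {x : EuclideanSpace ℝ ι | ∃ i, ∃ k : ℤ, |x i / h - j / N - k| < 1 / (2 * N)}, f l x ≤
      ((Fintype.card ι : ℝ≥0∞) * m / N) * ∫⁻ x, f l x := by
  classical
  -- the normalised collar masses
  set K : ℕ → Set (EuclideanSpace ℝ ι) :=
    fun j => {x : EuclideanSpace ℝ ι | ∃ i, ∃ k : ℤ, |x i / h - j / N - k| < 1 / (2 * N)} with hK
  set g : ℕ → ℝ≥0∞ := fun j => ∑ l : Fin m, (∫⁻ x in K j, f l x) / ∫⁻ x, f l x with hg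
  set b : ℝ≥0∞ := (Fintype.card ι : ℝ≥0∞) * m / N with hb
  have hNne : (N : ℝ≥0∞) ≠ 0 := by exact_mod_cast hN.ne'
  have hNtop : (N : ℝ≥0∞) ≠ ⊤ := ENNReal.natCast_ne_top N
  -- total of the normalised masses over the offsets
  have hsum : ∑ j ∈ Finset.range N, g j ≤ (Fintype.card ι : ℝ≥0∞) * m := by
    calc ∑ j ∈ Finset.range N, g j
        = ∑ l : Fin m, ∑ j ∈ Finset.range N, (∫⁻ x in K j, f l x) / ∫⁻ x, f l x := Finset.sum_comm
      _ = ∑ l : Fin m, (∑ j ∈ Finset.range N, ∫⁻ x in K j, f l x) / ∫⁻ x, f l x := by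
          refine Finset.sum_congr rfl fun l _ => ?_
          simp only [div_eq_mul_inv, Finset.sum_mul]
      _ ≤ ∑ l : Fin m, ((Fintype.card ι : ℝ≥0∞) * ∫⁻ x, f l x) / ∫⁻ x, f l x := by
          refine Finset.sum_le_sum fun l _ => ?_
          exact ENNReal.div_le_div_right (sum_lintegral_gridCollar_le h hN (f l)) _
      _ ≤ ∑ _l : Fin m, (Fintype.card ι : ℝ≥0∞) := by
          refine Finset.sum_le_sum fun l _ => ?_
          rw [mul_div_assoc]
          calc (Fintype.card ι : ℝ≥0∞) * ((∫⁻ x, f l x) / ∫⁻ x, f l x)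
              ≤ (Fintype.card ι : ℝ≥0∞) * 1 := by gcongr; exact ENNReal.div_self_le_one
            _ = (Fintype.card ι : ℝ≥0∞) := mul_one _
      _ = (Fintype.card ι : ℝ≥0∞) * m := by
          rw [Finset.sum_const, Finset.card_univ, Fintype.card_fin, nsmul_eq_mul, mul_comm]
  -- pigeonhole: some offset has `g j ≤ b`
  have hNb : ∑ _j ∈ Finset.range N, b = (Fintype.card ι : ℝ≥0∞) * m := by
    rw [Finset.sum_const, Finset.card_range, nsmul_eq_mul, hb, ENNReal.mul_div_cancel hNne hNtop]
  have hex : ∃ j ∈ Finset.range N, g j ≤ b := by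
    by_contra hcon
    push Not at hcon
    have hlt : ∑ _j ∈ Finset.range N, b < ∑ j ∈ Finset.range N, g j :=
      ENNReal.sum_lt_sum_of_nonempty ⟨0, Finset.mem_range.2 hN⟩ fun j hj => hcon j hj
    rw [hNb] at hlt
    exact absurd hsum (not_le.2 hlt)
  obtain ⟨j, hj, hgj⟩ := hex
  refine ⟨j, Finset.mem_range.1 hj, fun l => ?_⟩
  -- the `l`-th normalised mass is at most `g j ≤ b`
  have hl : (∫⁻ x in K j, f l x) / ∫⁻ x, f l x ≤ b :=
    (Finset.single_le_sum (f := fun l => (∫⁻ x in K j, f l x) / ∫⁻ x, f l x) (fun _ _ => zero_le)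
      (Finset.mem_univ l)).trans hgj
  show ∫⁻ x in K j, f l x ≤ b * ∫⁻ x, f l x
  rcases eq_or_ne (∫⁻ x, f l x) 0 with h0 | h0
  · have : ∫⁻ x in K j, f l x = 0 := le_antisymm ((setLIntegral_le_lintegral _ _).trans h0.le) zero_le
    rw [this]; exact zero_le
  · exact (ENNReal.div_le_iff_le_mul (Or.inl h0) (Or.inl (hfin l))).1 hl

/-- **Cheap collars, real form.** For `N ≥ 1` offsets and non-negative integrable densities `f₀, …, f_{m-1}` on
`EuclideanSpace ℝ ι`, some offset `j < N` gives `∫_{collar j} f_l ≤ (#ι · m / N) · ∫ f_l` for every `l`, where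
`collar j = {x | ∃ i, ∃ k : ℤ, |x i / h − j/N − k| < 1/(2N)}` is the `h/(2N)`-neighbourhood (coordinatewise) of the
faces of the cubic grid of side `h` shifted by `(j/N) h` along the diagonal. [folklore] -/
theorem exists_gridCollar_integral_le (h : ℝ) {N : ℕ} (hN : 0 < N) {m : ℕ} (f : Fin m → EuclideanSpace ℝ ι → ℝ)
    (hint : ∀ l, Integrable (f l)) (hnn : ∀ l x, 0 ≤ f l x) :
    ∃ j < N, ∀ l, ∫ x in {x : EuclideanSpace ℝ ι | ∃ i, ∃ k : ℤ, |x i / h - j / N - k| < 1 / (2 * N)}, f l x ≤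
      ((Fintype.card ι : ℝ) * m / N) * ∫ x, f l x := by
  have hfin : ∀ l, ∫⁻ x, ENNReal.ofReal (f l x) ≠ ⊤ := fun l =>
    ((hasFiniteIntegral_iff_ofReal (Eventually.of_forall (hnn l))).1 (hint l).hasFiniteIntegral).ne
  obtain ⟨j, hj, hle⟩ := exists_gridCollar_lintegral_le h hN (fun l x => ENNReal.ofReal (f l x)) hfin
  refine ⟨j, hj, fun l => ?_⟩
  set K : Set (EuclideanSpace ℝ ι) :=
    {x : EuclideanSpace ℝ ι | ∃ i, ∃ k : ℤ, |x i / h - j / N - k| < 1 / (2 * N)} with hK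
  have hNne : (N : ℝ≥0∞) ≠ 0 := by exact_mod_cast hN.ne'
  have hb : ((Fintype.card ι : ℝ≥0∞) * m / N).toReal = (Fintype.card ι : ℝ) * m / N := by
    rw [ENNReal.toReal_div, ENNReal.toReal_mul]
    simp
  have hbtop : (Fintype.card ι : ℝ≥0∞) * m / N ≠ ⊤ :=
    ENNReal.div_ne_top (ENNReal.mul_ne_top (ENNReal.natCast_ne_top _) (ENNReal.natCast_ne_top _)) hNne
  have h1 : ∫ x in K, f l x = (∫⁻ x in K, ENNReal.ofReal (f l x)).toReal :=
    integral_eq_lintegral_of_nonneg_ae (Eventually.of_forall (hnn l)) (hint l).aestronglyMeasurable.restrict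
  have h2 : ∫ x, f l x = (∫⁻ x, ENNReal.ofReal (f l x)).toReal :=
    integral_eq_lintegral_of_nonneg_ae (Eventually.of_forall (hnn l)) (hint l).aestronglyMeasurable
  rw [h1, h2, ← hb, ← ENNReal.toReal_mul]
  exact ENNReal.toReal_mono (ENNReal.mul_ne_top hbtop (hfin l)) (hle l)

end Grid

end Summit.NavierStokesRegularity.NavierStokesRegularity.Theorems.NearExtremalTransiencePerFlow.MemberSelection
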